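import Summits.KontsevichZagierPeriods.KontsevichZagierPeriods.Theorems.HurwitzMicroSectorsHurwitzSectorComplementStubLadderDescentWF
import Summits.KontsevichZagierPeriods.KontsevichZagierPeriods.Theorems.HurwitzMicroSectorsHurwitzSectorComplementStubLadderEngine
import Summits.KontsevichZagierPeriods.KontsevichZagierPeriods.Theorems.HurwitzMicroSectorsHurwitzSectorComplementStubArcSimplex
import Summits.KontsevichZagierPeriods.KontsevichZagierPeriods.Theorems.HurwitzMicroSectorsHurwitzSectorComplementStubBottomCell

/-!
# Crux `HurwitzSectorComplement` (stmt-KontsevichZagierPeriods-14341), line `chebyshev-level-deformation` —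
# the four descents of S3, UNCONDITIONALLY (registered sub-goal `ladderDescent_descents`)

Def-free, one theorem. S1 (`stub_ladderEngine`, the ladder engine), S2a (`stub_arcSimplex`, chains over
cyclotomic arcs and the half-line) and S2b (`stub_bottomCell`, the bottom cell `m = 1`) are landed
theorems of this directory, and S3 (`stub_ladderDescent`, the descent down the ladder) is landed in
`…StubLadderDescentWF` (p115187); composing them gives the four descents with no hypothesis left — exactly the
first hypothesis ("the four descents (conclusion of S3), verbatim") of S5 `stub_assembly` /
`parityTowerSector`: for `v₀ = tan(πj/L)` (`0 < j`, `2j < L`) the Chebyshev box representations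
`[(0,1)^w, T(v₀, x₁⋯x_w)]` (`w ≥ 2` even), `[(0,1)^w, U(v₀, x₁⋯x_w)]` (`w ≥ 3` odd) and the level-1/2
representations `[(0,1)^w, 1/(1−t)]`, `[(0,1)^w, 1/(1+t)]` (`w ≥ 2` even) are KZ-equivalent to rational
multiples of `𝔭_w = [(0,1)^w, ∏ 2/(1+x_i²)]` (value `(π/2)^w`).

References: M. Kontsevich, D. Zagier, *Periods* (2001), §1.2.
-/

noncomputable section

open Set MeasureTheory
open scoped BigOperators
open Literature.NumberTheory.Transcendental

namespace Summit.KontsevichZagierPeriods.Theorems.HurwitzMicroSectorsHurwitzSectorComplement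

/-- **The four descents, unconditionally** (registered sub-goal `ladderDescent_descents` of stub S3; the
hypothesis of S5 `stub_assembly` verbatim): S1 (`stub_ladderEngine`), S2a (`stub_arcSimplex`) and S2b
(`stub_bottomCell`) are theorems of this directory, so `stub_ladderDescent` discharges to: for
`v₀ = tan(πj/L)` (`0 < j`, `2j < L`), `[(0,1)^w, T(v₀, p)]` (`w ≥ 2` even), `[(0,1)^w, U(v₀, p)]`
(`w ≥ 3` odd), `[(0,1)^w, 1/(1−p)]` and `[(0,1)^w, 1/(1+p)]` (`w ≥ 2` even) all lie in `ℚ·𝔭_w`.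
[cite: KontsevichZagier2001, §1.2] -/
theorem ladderDescent_descents :
    (∀ (w j L : ℕ), 2 ≤ w → Even w → 0 < j → 2 * j < L → ∀ (r : KZ.IntegralRep w),
      r.domain = {x | ∀ i, x i ∈ Set.Ioo (0:ℝ) 1} →
      Set.EqOn r.integrand (fun x =>
        ((1 - ∏ i, x i) - (Real.tan (Real.pi * j / L)) ^ 2 * (1 + ∏ i, x i)) /
          ((1 - ∏ i, x i) ^ 2 + (Real.tan (Real.pi * j / L)) ^ 2 * (1 + ∏ i, x i) ^ 2)) r.domain →
      ∃ q : ℚ, ∀ (s : KZ.IntegralRep w), s.domain = {x | ∀ i, x i ∈ Set.Ioo (0:ℝ) 1} →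
        Set.EqOn s.integrand (fun x => (q : ℝ) * ∏ i, 2 / (1 + (x i) ^ 2)) s.domain →
        KZ.Equivalent r s) ∧
    (∀ (w j L : ℕ), 3 ≤ w → Odd w → 0 < j → 2 * j < L → ∀ (r : KZ.IntegralRep w),
      r.domain = {x | ∀ i, x i ∈ Set.Ioo (0:ℝ) 1} →
      Set.EqOn r.integrand (fun x =>
        2 * Real.tan (Real.pi * j / L) /
          ((1 - ∏ i, x i) ^ 2 + (Real.tan (Real.pi * j / L)) ^ 2 * (1 + ∏ i, x i) ^ 2)) r.domain →
      ∃ q : ℚ, ∀ (s : KZ.IntegralRep w), s.domain = {x | ∀ i, x i ∈ Set.Ioo (0:ℝ) 1} →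
        Set.EqOn s.integrand (fun x => (q : ℝ) * ∏ i, 2 / (1 + (x i) ^ 2)) s.domain →
        KZ.Equivalent r s) ∧
    (∀ (w : ℕ), 2 ≤ w → Even w → ∀ (r : KZ.IntegralRep w),
      r.domain = {x | ∀ i, x i ∈ Set.Ioo (0:ℝ) 1} →
      Set.EqOn r.integrand (fun x => 1 / (1 - ∏ i, x i)) r.domain →
      ∃ q : ℚ, ∀ (s : KZ.IntegralRep w), s.domain = {x | ∀ i, x i ∈ Set.Ioo (0:ℝ) 1} →
        Set.EqOn s.integrand (fun x => (q : ℝ) * ∏ i, 2 / (1 + (x i) ^ 2)) s.domain →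
        KZ.Equivalent r s) ∧
    (∀ (w : ℕ), 2 ≤ w → Even w → ∀ (r : KZ.IntegralRep w),
      r.domain = {x | ∀ i, x i ∈ Set.Ioo (0:ℝ) 1} →
      Set.EqOn r.integrand (fun x => 1 / (1 + ∏ i, x i)) r.domain →
      ∃ q : ℚ, ∀ (s : KZ.IntegralRep w), s.domain = {x | ∀ i, x i ∈ Set.Ioo (0:ℝ) 1} →
        Set.EqOn s.integrand (fun x => (q : ℝ) * ∏ i, 2 / (1 + (x i) ^ 2)) s.domain →
        KZ.Equivalent r s) :=
  stub_ladderDescent stub_ladderEngine stub_arcSimplex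
    (stub_bottomCell stub_arcSimplex.1 stub_arcSimplex.2)

end Summit.KontsevichZagierPeriods.Theorems.HurwitzMicroSectorsHurwitzSectorComplement

end
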